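import Summits.QuantumFields.YangMills.Theorems.BalabanUVNodesN19LawSummabilityThresholdSharp

/-!
# YM-DAG node N19 (= NE7 proper) — THE LAW-SUMMABILITY THRESHOLD BEYOND MONOTONE REMAINDERS: THE PATH CRITERION
# (freeze where the budget is small, move along a path; the arc chain needs only the minimum budget over three consecutive moves)

Cell `pub-ymgap`, HUMAN RULING D-0062 (Track A) ∕ D-0149 (work-bound push), R141 (C) wider-strategy seat `pub-ymgap-dag-n19-e` (strategy s3 =
ALTERNATIVE CURRENCY), generation g22, module 4 (lineage module 77).  Route `Summits/QuantumFields/YangMills/Theses/BalabanUVNodes.lean` rev 25,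
cluster item K3⁷ «SpineGivenEndpointR13SepCoPH» (stmt-QuantumFields-20544); filed `--supports` that item `--as helper` (it proves no registered
stub).  COUNT-NEUTRAL: [folklore] over Mathlib (`Nat.find`, `StrictMono`) + the lineage BY NAME — module 75 `…N19LawSummabilityThresholdSharp`
(`logRate_le_div_of_lt_stepCost`), module 74 (rate function), module 72 `exists_chebyshevArc_laws`, module 73 `pow_div_factorial_le_exp_mul_pow`,
module 64 `abs_log_sub_log_le_of_exp_neg_le` ∕ `exp_neg_le_mgf_id_of_Icc_symm`; `MatchingModConstants` (N19's DECL-target SHAPE) is CONCLUDED for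
explicit TOY families `Z_K = mgf λ_K`; no scheme object, no Theses import; NOT a discharge claim.

THE QUESTION (module 75's honest limit).  Modules 74 ∕ 75 settle the threshold `Σ_K r(log⁺(vol·δ_K)⁻¹) < ∞` EXACTLY for ANTITONE remainders.  For a
general `δ ≥ 0` the upper half (74) stands, but the lower-half witness of 75 uses monotonicity.  What survives without it?

THE ANSWER ★★ `exists_matchingModConstants_not_summable_lawIncrements_of_path` — THE PATH CRITERION: let `δ ≥ 0` and let `κ : ℕ → ℕ` be ANY
strictly increasing sequence of steps with `δ(κ_j) > 0` (the MOVES; every other step is FROZEN: `λ_{K+1} = λ_K`, increment `0 ≤ vol·δ_K`).  If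
`Σ_m r(log⁺(vol·m₃(m))⁻¹) = ∞`, where `m₃(m) = min{δ(κ_{2m−1}), δ(κ_{2m}), δ(κ_{2m+1})}` is the least budget among the three consecutive moves around the
`m`-th swap, then there are probability laws `λ_K` on `[−1,1]` with `MatchingModConstants vol l₀ δ (K t ↦ mgf λ_K t)` (constants `0`) and continuous
`1`-Lipschitz `1`-bounded tests with NON-summable increments.  THE SEQUENCE: the stage counter `i(K) = #{j : κ_j < K}` (`Nat.find` of the first
`κ_j ≥ K`; `StrictMono.id_le`) drives module 75's chain `X_{2m} = P_{n_m}`, `X_{2m+1} = Q_{n_m}` through `λ_K = X_{i(K)}`; the level `n_m = N + J_m` is the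
least whose step cost `4e^{l₀}l₀^{n−1}∕(n−1)!` fits `vol·m₃(m)` — the swap `P → Q` at move `κ_{2m}` costs `≤ cost(n_m) ≤ vol·δ(κ_{2m})`, the cross moves
`Q_{n_m} → P_{n_{m+1}}` at `κ_{2m+1}` cost `≤ ½cost(n_m) + ½cost(n_{m+1}) ≤ vol·δ(κ_{2m+1})` (both windows contain `κ_{2m+1}`; NO ordering of the levels
is needed), and the swap is paid exactly `1∕(2n_m) ≥ κ(l₀)·r(log⁺(vol·m₃(m))⁻¹)` (75's inversion lemma).  COROLLARY ★★
`exists_matchingModConstants_not_summable_lawIncrements_of_antitone_subseq`: it suffices that `δ ≥ 0` has a strictly increasing subsequence along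
which it is positive and ANTITONE with divergent rates — e.g. `δ_{2i} = θ^{2i}`, `δ_{2i+1} = e^{−(2i+1)²}` (module 75 does not apply; this file does, with
`κ_j = 2j`).  READING: the path criterion is the natural reach of the arc constructions — the gain of a move is the rate of the SMALLEST budget in
its window, so isolated large budgets between tiny ones are worth only their neighbours; whether `Σ_K r = ∞` alone suffices for a witness (some law
sequence beating every path) stays OPEN and is not claimed.

HONEST FRAMING (binding).  Elementary and [folklore]; TOY families; NO consumer in the DAG today (a structural statement about the seat's own
currencies); nothing of Bałaban's instantiated; NE7 NOT PRINTED, NOT proved; N19 NOT discharged; count-neutral.  One finite `T⁴` programme at fixed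
`ε`; nothing continuum ∕ `ℝ⁴` ∕ OS ∕ mass-gap ∕ Clay.  0 `def` ∕ 0 `sorry`.
-/

noncomputable section

open Real Filter Topology MeasureTheory ProbabilityTheory

namespace Summit.QuantumFields.YangMills.Theorems.BalabanUVNodesN19LawSummabilityThresholdPaths

open Literature.MathematicalPhysics.QuantumFieldTheory.Balaban1983to89
open T4CauchySum (MatchingModConstants)
open Summit.QuantumFields.BalabanUV.T4Continuum.Spine
open Summit.QuantumFields.YangMills.Theorems.BalabanUVNodesN19LawIncrementsTarget (abs_log_sub_log_le_of_exp_neg_le exp_neg_le_mgf_id_of_Icc_symm)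
open Summit.QuantumFields.YangMills.Theorems.BalabanUVNodesN19ChebyshevArcLaws (exists_chebyshevArc_laws)
open Summit.QuantumFields.YangMills.Theorems.BalabanUVNodesN19TargetNotLawSummableSharp (pow_div_factorial_le_exp_mul_pow)
open Summit.QuantumFields.YangMills.Theorems.BalabanUVNodesN19LawSummabilityThreshold
  (logRate_le_one logRate_pos logRate_posLog_inv_mono)
open Summit.QuantumFields.YangMills.Theorems.BalabanUVNodesN19LawSummabilityThresholdSharp (logRate_le_div_of_lt_stepCost)

/-- ★★ **THE PATH CRITERION.**  `l₀ > 0`, `vol > 0`, `δ ≥ 0`, `κ` strictly increasing with `δ(κ_j) > 0`, and the rates of the window minima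
`m₃(m) = min(δ(κ_{2m+1}), δ(κ_{2m}), δ(κ_{2m−1}))` NOT summable ⇒ probability laws `λ_K` on `[−1,1]` with `MatchingModConstants vol l₀ δ (K t ↦ mgf λ_K t)`
and continuous tests `g_K`, `1`-Lipschitz and `1`-bounded on `[−1,1]`, whose increments `|∫g_K dλ_{K+1} − ∫g_K dλ_K|` are NOT summable (frozen off the
path, module 75's chain along it at the levels of the window minima; header). [folklore] -/
theorem exists_matchingModConstants_not_summable_lawIncrements_of_path {l₀ vol : ℝ} (hl₀ : 0 < l₀) (hvol : 0 < vol) {δ : ℕ → ℝ}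
    (hδ : ∀ K, 0 ≤ δ K) {κ : ℕ → ℕ} (hκ : StrictMono κ) (hpos : ∀ j, 0 < δ (κ j))
    (hS : ¬ Summable fun m : ℕ =>
      Real.log (Real.exp 1 + Real.posLog (vol * min (δ (κ (2 * m + 1))) (min (δ (κ (2 * m))) (δ (κ (2 * m - 1)))))⁻¹) /
        (1 + Real.posLog (vol * min (δ (κ (2 * m + 1))) (min (δ (κ (2 * m))) (δ (κ (2 * m - 1)))))⁻¹)) :
    ∃ Λ : ℕ → Measure ℝ, (∀ K, IsProbabilityMeasure (Λ K)) ∧ (∀ K, Λ K (Set.Icc (-1 : ℝ) 1)ᶜ = 0) ∧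
      MatchingModConstants vol l₀ δ (fun K t => mgf id (Λ K) t) ∧
      ∃ g : ℕ → ℝ → ℝ, (∀ K, Continuous (g K)) ∧
        (∀ (K : ℕ) (x y : ℝ), x ∈ Set.Icc (-1 : ℝ) 1 → y ∈ Set.Icc (-1 : ℝ) 1 → |g K x - g K y| ≤ 1 * |x - y|) ∧
        (∀ (K : ℕ) (x : ℝ), x ∈ Set.Icc (-1 : ℝ) 1 → |g K x| ≤ 1) ∧
        ¬ Summable (fun K => |∫ x, g K x ∂Λ (K + 1) - ∫ x, g K x ∂Λ K|) := by
  classical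
  -- the window minima `μ₃ m > 0`
  set μ₃ : ℕ → ℝ := fun m => min (δ (κ (2 * m + 1))) (min (δ (κ (2 * m))) (δ (κ (2 * m - 1)))) with hμ₃
  have hμ₃pos : ∀ m, 0 < μ₃ m := fun m => lt_min (hpos _) (lt_min (hpos _) (hpos _))
  have hμ₃a : ∀ m, μ₃ m ≤ δ (κ (2 * m + 1)) := fun m => min_le_left _ _
  have hμ₃b : ∀ m, μ₃ m ≤ δ (κ (2 * m)) := fun m => (min_le_right _ _).trans (min_le_left _ _)
  have hμ₃c : ∀ m, μ₃ m ≤ δ (κ (2 * m - 1)) := fun m => (min_le_right _ _).trans (min_le_right _ _)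
  -- the base level `N = max(3, ⌈2l₀⌉)` and the arc laws at the levels `N + j`
  set N : ℕ := max 3 ⌈2 * l₀⌉₊ with hNdef
  have hN3 : 3 ≤ N := le_max_left _ _
  have hNl : 2 * l₀ ≤ N := (Nat.le_ceil _).trans (by exact_mod_cast le_max_right 3 ⌈2 * l₀⌉₊)
  choose P Q iP iQ hPc hQc hmgf g hgc hgL hgB hpay using fun j : ℕ => exists_chebyshevArc_laws (n := N + j) (by omega)
  haveI : ∀ j, IsProbabilityMeasure (P j) := iP
  haveI : ∀ j, IsProbabilityMeasure (Q j) := iQ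
  -- the window remainder `b j` and the step cost `4e^{l₀} b j`, eventually below every positive budget
  set b : ℕ → ℝ := fun j => l₀ ^ (N + j - 1) / ((N + j - 1).factorial : ℝ) with hbdef
  have hb0 : ∀ j, 0 ≤ b j := fun j => by positivity
  have hcost_small : ∀ x : ℝ, 0 < x → ∃ j : ℕ, 4 * Real.exp l₀ * b j ≤ x := by
    intro x hx
    set C : ℝ := 4 * Real.exp l₀ * Real.exp (l₀ / (1 / 2) ^ 2) with hC
    have hC0 : 0 < C := by positivity
    obtain ⟨n, hn⟩ := exists_pow_lt_of_lt_one (div_pos hx hC0) (by norm_num : (1 / 2 : ℝ) < 1)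
    refine ⟨n, ?_⟩
    have h := pow_div_factorial_le_exp_mul_pow hl₀.le (by norm_num : (0 : ℝ) < 1 / 2) (N + n - 1)
    have hK : n ≤ 2 * (N + n - 1) := by omega
    have hpow : (1 / 2 : ℝ) ^ (2 * (N + n - 1)) ≤ (1 / 2 : ℝ) ^ n := pow_le_pow_of_le_one (by norm_num) (by norm_num) hK
    calc 4 * Real.exp l₀ * b n ≤ 4 * Real.exp l₀ * (Real.exp (l₀ / (1 / 2) ^ 2) * (1 / 2 : ℝ) ^ n) :=
          mul_le_mul_of_nonneg_left (h.trans (mul_le_mul_of_nonneg_left hpow (by positivity))) (by positivity)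
      _ = C * (1 / 2 : ℝ) ^ n := by rw [hC]; ring
      _ ≤ C * (x / C) := mul_le_mul_of_nonneg_left hn.le hC0.le
      _ = x := by field_simp
  -- THE LEVEL OF THE WINDOW MINIMUM
  have hex : ∀ m : ℕ, ∃ j : ℕ, 4 * Real.exp l₀ * b j ≤ vol * μ₃ m := fun m => hcost_small _ (mul_pos hvol (hμ₃pos m))
  let J : ℕ → ℕ := fun m => Nat.find (hex m)
  have hJspec : ∀ m, 4 * Real.exp l₀ * b (J m) ≤ vol * μ₃ m := fun m => Nat.find_spec (hex m)
  have hJmin : ∀ m j, j < J m → vol * μ₃ m < 4 * Real.exp l₀ * b j := fun m j hj => not_le.1 (Nat.find_min (hex m) hj)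
  -- the mgfs against the ONE base
  have hbase : ∀ (j : ℕ) (t : ℝ), |t| ≤ l₀ →
      |mgf id (P j) t - 1 / 2 * ∫ x in (-1 : ℝ)..1, Real.exp (t * x)| ≤ 2 * b j ∧
      |mgf id (Q j) t - 1 / 2 * ∫ x in (-1 : ℝ)..1, Real.exp (t * x)| ≤ 2 * b j := fun j t ht =>
    hmgf j l₀ t (by push_cast; linarith) ht
  have hmgfPQ : ∀ (j : ℕ) (t : ℝ), |t| ≤ l₀ → |mgf id (Q j) t - mgf id (P j) t| ≤ 4 * b j := fun j t ht => by
    obtain ⟨h1, h2⟩ := hbase j t ht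
    calc |mgf id (Q j) t - mgf id (P j) t|
        ≤ |mgf id (Q j) t - 1 / 2 * ∫ x in (-1 : ℝ)..1, Real.exp (t * x)| +
          |1 / 2 * (∫ x in (-1 : ℝ)..1, Real.exp (t * x)) - mgf id (P j) t| := abs_sub_le _ _ _
      _ = |mgf id (Q j) t - 1 / 2 * ∫ x in (-1 : ℝ)..1, Real.exp (t * x)| +
          |mgf id (P j) t - 1 / 2 * ∫ x in (-1 : ℝ)..1, Real.exp (t * x)| := by rw [abs_sub_comm (1 / 2 * _) (mgf id (P j) t)]
      _ ≤ 2 * b j + 2 * b j := add_le_add h2 h1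
      _ = 4 * b j := by ring
  have hmgfQP : ∀ (i j : ℕ) (t : ℝ), |t| ≤ l₀ → |mgf id (P j) t - mgf id (Q i) t| ≤ 2 * b j + 2 * b i := fun i j t ht => by
    obtain ⟨-, h2⟩ := hbase i t ht
    obtain ⟨h1, -⟩ := hbase j t ht
    calc |mgf id (P j) t - mgf id (Q i) t|
        ≤ |mgf id (P j) t - 1 / 2 * ∫ x in (-1 : ℝ)..1, Real.exp (t * x)| +
          |1 / 2 * (∫ x in (-1 : ℝ)..1, Real.exp (t * x)) - mgf id (Q i) t| := abs_sub_le _ _ _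
      _ = |mgf id (P j) t - 1 / 2 * ∫ x in (-1 : ℝ)..1, Real.exp (t * x)| +
          |mgf id (Q i) t - 1 / 2 * ∫ x in (-1 : ℝ)..1, Real.exp (t * x)| := by rw [abs_sub_comm (1 / 2 * _) (mgf id (Q i) t)]
      _ ≤ 2 * b j + 2 * b i := add_le_add h1 h2
  -- THE STAGE COUNTER `i K` = the first `j` with `K ≤ κ j` (= number of moves before `K`)
  have hexi : ∀ K : ℕ, ∃ j : ℕ, K ≤ κ j := fun K => ⟨K, hκ.le_apply⟩
  let ι : ℕ → ℕ := fun K => Nat.find (hexi K)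
  have hιspec : ∀ K, K ≤ κ (ι K) := fun K => Nat.find_spec (hexi K)
  have hι_at : ∀ j, ι (κ j) = j := fun j =>
    (Nat.find_eq_iff (hexi (κ j))).2 ⟨le_rfl, fun j' hj' => not_le.2 (hκ hj')⟩
  have hι_succ_at : ∀ j, ι (κ j + 1) = j + 1 := fun j =>
    (Nat.find_eq_iff (hexi (κ j + 1))).2 ⟨Nat.succ_le_of_lt (hκ (Nat.lt_succ_self j)), fun j' hj' => not_le.2 (Nat.lt_succ_of_le (hκ.monotone (Nat.le_of_lt_succ hj')))⟩
  have hι_frozen : ∀ K, (∀ j, κ j ≠ K) → ι (K + 1) = ι K := fun K hK => by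
    refine (Nat.find_eq_iff (hexi (K + 1))).2 ⟨?_, fun j' hj' => ?_⟩
    · exact Nat.succ_le_of_lt (lt_of_le_of_ne (hιspec K) (fun h => hK _ h.symm))
    · exact fun h => (Nat.find_min (hexi K) hj') ((Nat.le_succ K).trans h)
  -- the chain along the path, the sequence, the tests
  set X : ℕ → Measure ℝ := fun j => if Even j then P (J (j / 2)) else Q (J (j / 2)) with hX
  have hXP : ∀ j, IsProbabilityMeasure (X j) := fun j => by simp only [hX]; split_ifs <;> infer_instance
  have hXc : ∀ j, X j (Set.Icc (-1 : ℝ) 1)ᶜ = 0 := fun j => by simp only [hX]; split_ifs; exacts [hPc _, hQc _]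
  -- the chain's steps cost `≤ vol·δ(κ j)` in cgf
  have hchain : ∀ (j : ℕ) (t : ℝ), |t| ≤ l₀ → |cgf id (X (j + 1)) t - cgf id (X j) t| ≤ vol * δ (κ j) := by
    intro j t ht
    have hlow : ∀ j, Real.exp (-l₀) ≤ mgf id (X j) t := fun j => by
      haveI := hXP j
      exact exp_neg_le_mgf_id_of_Icc_symm (X j) (hXc j) ht
    have hm : Real.exp l₀ * |mgf id (X (j + 1)) t - mgf id (X j) t| ≤ vol * δ (κ j) := by
      rcases Nat.even_or_odd j with ⟨m, rfl⟩ | ⟨m, rfl⟩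
      · -- swap at move `2m`: `P_{J m} → Q_{J m}`, cost `≤ 4e^{l₀} b (J m) ≤ vol μ₃ m ≤ vol δ(κ(2m))`
        have h1 : ¬Even (m + m + 1) := by rw [Nat.not_even_iff_odd]; exact ⟨m, by ring⟩
        have e1 : (m + m) / 2 = m := by omega
        have e2 : (m + m + 1) / 2 = m := by omega
        simp only [hX, Even.add_self m, if_true, h1, if_false, e1, e2]
        have e3 : m + m = 2 * m := by ring
        calc Real.exp l₀ * |mgf id (Q (J m)) t - mgf id (P (J m)) t| ≤ Real.exp l₀ * (4 * b (J m)) :=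
              mul_le_mul_of_nonneg_left (hmgfPQ (J m) t ht) (Real.exp_pos _).le
          _ = 4 * Real.exp l₀ * b (J m) := by ring
          _ ≤ vol * μ₃ m := hJspec m
          _ ≤ vol * δ (κ (m + m)) := by rw [e3]; exact mul_le_mul_of_nonneg_left (hμ₃b m) hvol.le
      · -- cross move `2m+1`: `Q_{J m} → P_{J (m+1)}`, cost `≤ ½cost(J m) + ½cost(J (m+1)) ≤ vol δ(κ(2m+1))`
        have h0 : ¬Even (2 * m + 1) := Nat.not_even_iff_odd.2 ⟨m, rfl⟩
        have h1 : Even (2 * m + 1 + 1) := ⟨m + 1, by ring⟩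
        have e1 : (2 * m + 1) / 2 = m := by omega
        have e2 : (2 * m + 1 + 1) / 2 = m + 1 := by omega
        simp only [hX, h0, if_false, h1, if_true, e1, e2]
        have hA : 4 * Real.exp l₀ * b (J m) ≤ vol * δ (κ (2 * m + 1)) :=
          (hJspec m).trans (mul_le_mul_of_nonneg_left (hμ₃a m) hvol.le)
        have hB : 4 * Real.exp l₀ * b (J (m + 1)) ≤ vol * δ (κ (2 * m + 1)) := by
          have e3 : 2 * (m + 1) - 1 = 2 * m + 1 := by omega
          have h := (hJspec (m + 1)).trans (mul_le_mul_of_nonneg_left (hμ₃c (m + 1)) hvol.le)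
          rwa [e3] at h
        calc Real.exp l₀ * |mgf id (P (J (m + 1))) t - mgf id (Q (J m)) t| ≤ Real.exp l₀ * (2 * b (J (m + 1)) + 2 * b (J m)) :=
              mul_le_mul_of_nonneg_left (hmgfQP (J m) (J (m + 1)) t ht) (Real.exp_pos _).le
          _ = (4 * Real.exp l₀ * b (J (m + 1))) / 2 + (4 * Real.exp l₀ * b (J m)) / 2 := by ring
          _ ≤ vol * δ (κ (2 * m + 1)) / 2 + vol * δ (κ (2 * m + 1)) / 2 := by gcongr
          _ = vol * δ (κ (2 * m + 1)) := by ring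
    calc |cgf id (X (j + 1)) t - cgf id (X j) t| = |Real.log (mgf id (X (j + 1)) t) - Real.log (mgf id (X j) t)| := by rw [cgf, cgf]
      _ ≤ Real.exp l₀ * |mgf id (X (j + 1)) t - mgf id (X j) t| := abs_log_sub_log_le_of_exp_neg_le (hlow _) (hlow _)
      _ ≤ vol * δ (κ j) := hm
  refine ⟨fun K => X (ι K), fun K => hXP _, fun K => hXc _, fun K => ⟨0, fun t ht => ?_⟩, fun K => g (J (ι K / 2)), fun K => hgc _,
    fun K x y hx hy => hgL _ x y hx hy, fun K x hx => (hgB _ x hx).trans ?_, fun hSum => ?_⟩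
  · -- matching modulo the constants `0`: a move costs `≤ vol δ(κ j) = vol δ_K`, a frozen step costs `0 ≤ vol δ_K`
    rw [sub_zero]
    change |cgf id (X (ι (K + 1))) t - cgf id (X (ι K)) t| ≤ vol * δ K
    by_cases hK : ∃ j, κ j = K
    · obtain ⟨j, rfl⟩ := hK
      rw [hι_at, hι_succ_at]
      exact hchain j t ht
    · rw [hι_frozen K (fun j h => hK ⟨j, h⟩), sub_self, abs_zero]
      exact mul_nonneg hvol.le (hδ K)
  · -- `1∕(2(N + J)) ≤ 1`
    rw [div_le_one (by positivity)]
    have : (1 : ℝ) ≤ ((N + J (ι K / 2) : ℕ) : ℝ) := by exact_mod_cast (by omega : 1 ≤ N + J (ι K / 2))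
    linarith
  · -- NOT SUMMABLE.  The swap moves `K = κ(2m)` pay exactly `1∕(2(N + J m))`.
    have hinj : Function.Injective fun m : ℕ => κ (2 * m) := fun a c h => by
      have := hκ.injective h
      omega
    have h2 := hSum.comp_injective hinj
    have h3 : ∀ m : ℕ, |∫ x, g (J (ι (κ (2 * m)) / 2)) x ∂X (ι (κ (2 * m) + 1)) - ∫ x, g (J (ι (κ (2 * m)) / 2)) x ∂X (ι (κ (2 * m)))| =
        1 / (2 * ((N + J m : ℕ) : ℝ)) := by
      intro m
      have h0 : ¬Even (2 * m + 1) := Nat.not_even_iff_odd.2 ⟨m, rfl⟩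
      have e1 : 2 * m / 2 = m := by omega
      have e2 : (2 * m + 1) / 2 = m := by omega
      rw [hι_at, hι_succ_at]
      simp only [hX, even_two_mul, if_true, h0, if_false, e1, e2]
      rw [abs_sub_comm, hpay (J m), abs_of_pos (by positivity)]
    simp only [Function.comp_def] at h2
    simp_rw [h3] at h2
    -- the rates of the window minima
    set r : ℕ → ℝ := fun m => Real.log (Real.exp 1 + Real.posLog (vol * μ₃ m)⁻¹) / (1 + Real.posLog (vol * μ₃ m)⁻¹) with hrdef
    have hr0 : ∀ m, 0 ≤ r m := fun m => (logRate_pos Real.posLog_nonneg).le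
    have hr1 : ∀ m, r m ≤ 1 := fun m => logRate_le_one Real.posLog_nonneg
    -- THE INVERSION at the swap moves: `κ₀·r m ≤ 1∕(2(N + J m))`
    set K₀ : ℕ := max ⌈8 * l₀ + 12⌉₊ ⌈Real.exp (2 * (1 + Real.log l₀))⌉₊ with hK₀
    set κ₀ : ℝ := 1 / (72 + 2 * ((N : ℝ) + K₀ + 2)) with hκ₀
    have hκ₀0 : 0 < κ₀ := by positivity
    have hκ₀72 : κ₀ ≤ 1 / 72 :=
      one_div_le_one_div_of_le (by norm_num) (by linarith [show (0 : ℝ) ≤ 2 * ((N : ℝ) + K₀ + 2) by positivity])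
    have hkey : ∀ m : ℕ, κ₀ * r m ≤ 1 / (2 * ((N + J m : ℕ) : ℝ)) := by
      intro m
      have hnpos : (0 : ℝ) < ((N + J m : ℕ) : ℝ) := by exact_mod_cast (by omega : 0 < N + J m)
      by_cases hsmall : N + J m ≤ N + K₀ + 2
      · have h1 : κ₀ * r m ≤ κ₀ := mul_le_of_le_one_right hκ₀0.le (hr1 _)
        have hle : ((N + J m : ℕ) : ℝ) ≤ (N : ℝ) + K₀ + 2 := by exact_mod_cast hsmall
        have h4 : κ₀ ≤ 1 / (2 * ((N + J m : ℕ) : ℝ)) := one_div_le_one_div_of_le (by positivity) (by linarith)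
        exact h1.trans h4
      · rw [not_le] at hsmall
        have hlt := hJmin m (J m - 1) (by omega)
        set k : ℕ := N + (J m - 1) - 1 with hkdef
        have hkK₀ : K₀ ≤ k := by omega
        have hk_ge1 : (⌈8 * l₀ + 12⌉₊ : ℝ) ≤ k := by exact_mod_cast (le_max_left _ _).trans hkK₀
        have hk_ge2 : (⌈Real.exp (2 * (1 + Real.log l₀))⌉₊ : ℝ) ≤ k := by exact_mod_cast (le_max_right _ _).trans hkK₀
        have hkb : 8 * l₀ + 12 ≤ (k : ℝ) := (Nat.le_ceil _).trans hk_ge1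
        have hk4 : 4 ≤ k := by
          have : (4 : ℝ) ≤ k := by linarith
          exact_mod_cast this
        have hkpos : (0 : ℝ) < k := by linarith
        have hka : 2 * (1 + Real.log l₀) ≤ Real.log k := by
          rw [Real.le_log_iff_exp_le hkpos]
          exact (Nat.le_ceil _).trans hk_ge2
        have hb_eq : b (J m - 1) = l₀ ^ k / (k.factorial : ℝ) := by simp only [hbdef, hkdef]
        rw [hb_eq] at hlt
        have hrate : r m ≤ 12 / k := logRate_le_div_of_lt_stepCost hl₀ (mul_pos hvol (hμ₃pos _)) hk4 hka hkb hlt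
        have hk3 : ((N + J m : ℕ) : ℝ) ≤ 3 * k := by exact_mod_cast (by omega : N + J m ≤ 3 * k)
        calc κ₀ * r m ≤ (1 / 72) * (12 / k) := mul_le_mul hκ₀72 hrate (hr0 _) (by norm_num)
          _ = 1 / (6 * k) := by
              field_simp
              ring
          _ ≤ 1 / (2 * ((N + J m : ℕ) : ℝ)) := one_div_le_one_div_of_le (by positivity) (by linarith)
    exact hS (Summable.of_nonneg_of_le (fun m => hr0 _) (fun m => (le_div_iff₀' hκ₀0).2 (hkey m)) (h2.div_const κ₀))

/-- ★★ **COROLLARY: AN ANTITONE SUBSEQUENCE WITH DIVERGENT RATES SUFFICES.**  `δ ≥ 0`; `κ` strictly increasing with `δ ∘ κ` positive, antitone and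
`Σ_j r(log⁺(vol·δ(κ_j))⁻¹) = ∞` ⇒ the same conclusion (the window minimum is `δ(κ_{2m+1})`; even ∕ odd transfer as in module 75).  Covers e.g.
`δ_{2i} = θ^{2i}`, `δ_{2i+1} = e^{−(2i+1)²}` with `κ_j = 2j`, where `δ` itself is not monotone. [folklore] -/
theorem exists_matchingModConstants_not_summable_lawIncrements_of_antitone_subseq {l₀ vol : ℝ} (hl₀ : 0 < l₀) (hvol : 0 < vol) {δ : ℕ → ℝ}
    (hδ : ∀ K, 0 ≤ δ K) {κ : ℕ → ℕ} (hκ : StrictMono κ) (hpos : ∀ j, 0 < δ (κ j)) (hanti : Antitone (δ ∘ κ))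
    (hS : ¬ Summable fun j : ℕ => Real.log (Real.exp 1 + Real.posLog (vol * δ (κ j))⁻¹) / (1 + Real.posLog (vol * δ (κ j))⁻¹)) :
    ∃ Λ : ℕ → Measure ℝ, (∀ K, IsProbabilityMeasure (Λ K)) ∧ (∀ K, Λ K (Set.Icc (-1 : ℝ) 1)ᶜ = 0) ∧
      MatchingModConstants vol l₀ δ (fun K t => mgf id (Λ K) t) ∧
      ∃ g : ℕ → ℝ → ℝ, (∀ K, Continuous (g K)) ∧
        (∀ (K : ℕ) (x y : ℝ), x ∈ Set.Icc (-1 : ℝ) 1 → y ∈ Set.Icc (-1 : ℝ) 1 → |g K x - g K y| ≤ 1 * |x - y|) ∧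
        (∀ (K : ℕ) (x : ℝ), x ∈ Set.Icc (-1 : ℝ) 1 → |g K x| ≤ 1) ∧
        ¬ Summable (fun K => |∫ x, g K x ∂Λ (K + 1) - ∫ x, g K x ∂Λ K|) := by
  refine exists_matchingModConstants_not_summable_lawIncrements_of_path hl₀ hvol hδ hκ hpos fun hS3 => hS ?_
  -- the window minimum is the last budget: `min(δκ(2m+1), δκ(2m), δκ(2m−1)) = δκ(2m+1)`
  have hmin : ∀ m : ℕ, min (δ (κ (2 * m + 1))) (min (δ (κ (2 * m))) (δ (κ (2 * m - 1)))) = δ (κ (2 * m + 1)) := fun m =>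
    min_eq_left (le_min (hanti (by omega)) (hanti (by omega)))
  simp_rw [hmin] at hS3
  -- rates along the subsequence are antitone: odd ones summable ⇒ even ones summable ⇒ all summable
  set r : ℕ → ℝ := fun j => Real.log (Real.exp 1 + Real.posLog (vol * δ (κ j))⁻¹) / (1 + Real.posLog (vol * δ (κ j))⁻¹) with hrdef
  have hr0 : ∀ j, 0 ≤ r j := fun j => (logRate_pos Real.posLog_nonneg).le
  have hr_anti : ∀ {j j' : ℕ}, j ≤ j' → r j' ≤ r j := fun {j j'} h =>
    logRate_posLog_inv_mono (mul_pos hvol (hpos j')) (mul_le_mul_of_nonneg_left (hanti h) hvol.le)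
  have hodd : Summable (fun m : ℕ => r (2 * m + 1)) := hS3
  have heven : Summable (fun m : ℕ => r (2 * m)) := by
    have h1 : Summable (fun m : ℕ => r (2 * (m + 1))) :=
      Summable.of_nonneg_of_le (fun m => hr0 _) (fun m => hr_anti (by omega)) hodd
    exact (summable_nat_add_iff 1).1 h1
  exact Summable.even_add_odd heven hodd

end Summit.QuantumFields.YangMills.Theorems.BalabanUVNodesN19LawSummabilityThresholdPaths

end
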